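import Literature.Probability.Percolation.ZdFiveArmSeparatedGluing
import HarnessLib

/-!
# Kesten's well-separated five-arm event with EDGE-disjoint right arms (`zdFiveArmSepE`)

Topic `Literature/Probability/Percolation`; critical bond percolation on `ℤ²`.  Definitions and
deterministic lemmas only (no named fact).

`ZdFiveArmSeparated.lean` renders Nolin's `Ã̃^{η,I/η',I'}_{5,σ}(n,N)` (`σ = BWBBW`) as
`zdFiveArmSep n N`, whose two fenced open arms landing on the right sides are asked to have
VERTEX-disjoint carriers.  The five-arm event of the tree, `zdFiveArmClusters m n`
(`ZdFourArmFromFiveArm.lean`), only asks its third open crossing to be EDGE-disjoint from the first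
two ("three open arms, two of which may touch"), and Kesten's separation construction (Kesten 1987,
Lemma 4; Nolin 2008, Thm. 11 and Lemma 15 of the arXiv text: the tips of the arms are replaced by
pieces of the successive lowest crossings, which for touching arms are successive lowest
EDGE-disjoint crossings) does not make touching arms vertex-disjoint.  The honest target of the
separation theorem for `zdFiveArmClusters` is therefore the event of this file,

* `zdFiveArmSepE n N = (zdSepOpenPairRE n N ∩ zdSepOpenArmL n N) ∩ (zdSepDualArmT n N ∩ zdSepDualArmB n N)`,

identical to `zdFiveArmSep n N` except that the two fenced right arms `R⁺`, `R⁻` are only asked to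
have disjoint EDGE carriers (`ZdSepOpenArmR.edgeCarrier`: the edges of the body, of the two fence
crossings and of the two attaching walks).  `zdFiveArmSep n N ⊆ zdFiveArmSepE n N`.  The downstream
steps `(U)` and `(Q)` of the five-arm upper bound are re-derived from the weaker hypothesis in
`ZdFiveArmPointBoundOfSeparationE.lean` (through the edge-disjoint uniqueness `zdFiveArmKSZ3`) and
`ZdFiveArmQuasiMultOfSeparationE.lean`.

## Contents

* `ZdSepOpenArmR.edgeCarrier`, `edgeCarrier_mono`, `edgeCarrier_transport`,
  `mem_carrier_of_mem_edgeCarrier`;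
* `zdSepOpenPairRE`, `zdFiveArmSepE` (DEFINITIONS), `zdSepOpenPairR_subset_zdSepOpenPairRE`,
  `zdFiveArmSep_subset_zdFiveArmSepE`, `isUpperSet_zdSepOpenPairRE`,
  `isUpperSet_zdSepOpenPairRE_inter_zdSepOpenArmL`, `determinedBy_zdSepOpenPairRE`,
  `zdFiveArmSepE_subset_sqAnnulusOpenCrossing`;
* `ZdSepOpenArmR.exists_walk_of_outerCorridorE`, `ZdSepOpenArmR.exists_walk_of_innerCorridorE` — the
  gluing lemmas of `ZdFiveArmSeparatedGluing.lean` for the right arm with the extra bookkeeping that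
  the glued walk uses only edges of the edge carrier (the proofs there already build it so).

## References

* H. Kesten, *Scaling relations for 2D-percolation*, CMP 109 (1987), §2 (2.26)–(2.28), Lemma 4
  [KestenScalingCMP1987].
* P. Nolin, *Near-critical percolation in two dimensions*, EJP 13 (2008), §4.2–4.4 (arXiv 0711.4948:
  Def. 6–8, Thm. 10, Lemma 14) [Nolin2008].
* D. Chelkak, H. Duminil-Copin, C. Hongler, EJP 21 (2016), §5.2 ("mutually edge-avoiding" arms)
  [ChelkakDuminilCopinHongler2016].

Tree: `ZdFiveArmSeparated.lean`, `ZdFiveArmSeparatedGluing.lean` (everything reused).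
-/

noncomputable section

open Set _root_.MeasureTheory

namespace Literature.Probability.Percolation

open LatticeModels SimpleGraph

/-! ### The edge carrier of a fenced right arm -/

namespace ZdSepOpenArmR

variable {ω ω' : BondConfig (Site 2)} {n N : ℕ} {lo hi lo' hi' : ℤ}

/-- **The edges used by a fenced right arm**: those of the body, of the two fence crossings and of the
two attaching walks. [folklore] -/
def edgeCarrier (A : ZdSepOpenArmR ω n N lo hi lo' hi') : Set (Sym2 (Site 2)) :=
  {e | e ∈ A.W.edges ∨ e ∈ A.V.edges ∨ e ∈ A.P.edges ∨ e ∈ A.V'.edges ∨ e ∈ A.P'.edges}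

/-- `mono` does not change the edge carrier. [folklore] -/
@[simp] theorem edgeCarrier_mono (A : ZdSepOpenArmR ω n N lo hi lo' hi') (h : ω ⊆ ω') :
    (A.mono h).edgeCarrier = A.edgeCarrier := rfl

/-- `transport` does not change the edge carrier. [folklore] -/
@[simp] theorem edgeCarrier_transport (A : ZdSepOpenArmR ω n N lo hi lo' hi')
    (h : ∀ e : Sym2 (Site 2), (∀ x ∈ e, x ∈ A.carrier) → e ∈ ω → e ∈ ω') :
    (A.transport h).edgeCarrier = A.edgeCarrier := rfl

/-- The endpoints of an edge of the edge carrier are sites of the carrier. [folklore] -/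
theorem mem_carrier_of_mem_edgeCarrier (A : ZdSepOpenArmR ω n N lo hi lo' hi') {e : Sym2 (Site 2)}
    (he : e ∈ A.edgeCarrier) {x : Site 2} (hx : x ∈ e) : x ∈ A.carrier := by
  rcases he with he | he | he | he | he
  · exact Or.inl (forall_mem_support_of_mem_edges A.W he x hx)
  · exact Or.inr (Or.inl (forall_mem_support_of_mem_edges A.V he x hx))
  · exact Or.inr (Or.inr (Or.inl (forall_mem_support_of_mem_edges A.P he x hx)))
  · exact Or.inr (Or.inr (Or.inr (Or.inl (forall_mem_support_of_mem_edges A.V' he x hx))))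
  · exact Or.inr (Or.inr (Or.inr (Or.inr (forall_mem_support_of_mem_edges A.P' he x hx))))

/-- Every edge of the edge carrier is open. [folklore] -/
theorem mem_of_mem_edgeCarrier (A : ZdSepOpenArmR ω n N lo hi lo' hi') {e : Sym2 (Site 2)}
    (he : e ∈ A.edgeCarrier) : e ∈ ω := by
  rcases he with he | he | he | he | he
  exacts [A.hWo e he, A.hVo e he, A.hPo e he, A.hV'o e he, A.hP'o e he]

/-- Vertex-disjoint carriers have disjoint edge carriers. [folklore] -/
theorem disjoint_edgeCarrier_of_disjoint_carrier {lo₂ hi₂ lo₂' hi₂' : ℤ}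
    (A : ZdSepOpenArmR ω n N lo hi lo' hi') (B : ZdSepOpenArmR ω n N lo₂ hi₂ lo₂' hi₂')
    (h : Disjoint A.carrier B.carrier) : Disjoint A.edgeCarrier B.edgeCarrier := by
  refine Set.disjoint_left.2 fun e heA heB => ?_
  obtain ⟨x, hx⟩ : ∃ x, x ∈ e := ⟨e.out.1, Sym2.out_fst_mem e⟩
  exact Set.disjoint_left.1 h (A.mem_carrier_of_mem_edgeCarrier heA hx)
    (B.mem_carrier_of_mem_edgeCarrier heB hx)

end ZdSepOpenArmR

/-! ### The events -/

/-- **The two fenced open arms landing on the right sides, EDGE-disjoint**: `R⁺` with landing heights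
`[n/4, n/4 + n/64]` inside and `[N/4, N/4 + N/64]` outside, `R⁻` with the opposite heights, and
disjoint edge carriers (bodies, fences and attaching walks may touch but share no edge) — the form in
which Kesten's separation construction delivers two open arms of the same colour that are only
edge-disjoint (Kesten 1987, Lemma 4; Nolin 2008, Lemma 15 [arXiv: Lemma 14], successive lowest
edge-disjoint crossings). [cite: KestenScalingCMP1987, §2 (2.26)–(2.28), Lemma 4] [cite: Nolin2008, §4.2 (arXiv 0711.4948 Def. 6–8)] -/
def zdSepOpenPairRE (n N : ℕ) : Set (BondConfig (Site 2)) :=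
  {ω | ∃ (A : ZdSepOpenArmR ω n N (n / 4 : ℕ) ((n / 4 : ℕ) + (n / 64 : ℕ))
      (N / 4 : ℕ) ((N / 4 : ℕ) + (N / 64 : ℕ)))
    (B : ZdSepOpenArmR ω n N (-((n / 4 : ℕ) + (n / 64 : ℕ) : ℤ)) (-(n / 4 : ℕ))
      (-((N / 4 : ℕ) + (N / 64 : ℕ) : ℤ)) (-(N / 4 : ℕ))),
    Disjoint A.edgeCarrier B.edgeCarrier}

/-- **Kesten's well-separated five-arm event with edge-disjoint right arms** `𝒜̃₅ᴱ(A_{n,N})`: two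
fenced open arms to the right sides with disjoint edge carriers, a fenced open arm to the left sides,
fenced closed dual arms to the top and to the bottom sides — an increasing event meet a decreasing
one; `zdFiveArmSep n N ⊆ zdFiveArmSepE n N`. [cite: Nolin2008, §4.2 (arXiv 0711.4948 Def. 6–8, the events Ã̃)] [cite: KestenScalingCMP1987, §2 (2.26)–(2.28)] -/
def zdFiveArmSepE (n N : ℕ) : Set (BondConfig (Site 2)) :=
  (zdSepOpenPairRE n N ∩ zdSepOpenArmL n N) ∩ (zdSepDualArmT n N ∩ zdSepDualArmB n N)

/-- Vertex-disjoint right arms are edge-disjoint right arms. [folklore] -/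
theorem zdSepOpenPairR_subset_zdSepOpenPairRE (n N : ℕ) : zdSepOpenPairR n N ⊆ zdSepOpenPairRE n N := by
  rintro ω ⟨A, B, hAB⟩
  exact ⟨A, B, A.disjoint_edgeCarrier_of_disjoint_carrier B hAB⟩

/-- `zdFiveArmSep n N ⊆ zdFiveArmSepE n N`. [folklore] -/
theorem zdFiveArmSep_subset_zdFiveArmSepE (n N : ℕ) : zdFiveArmSep n N ⊆ zdFiveArmSepE n N :=
  Set.inter_subset_inter_left _
    (Set.inter_subset_inter_left _ (zdSepOpenPairR_subset_zdSepOpenPairRE n N))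

/-- Unfolding `zdFiveArmSepE`. [folklore] -/
theorem zdFiveArmSepE_eq (n N : ℕ) : zdFiveArmSepE n N =
    zdSepOpenPairRE n N ∩ zdSepOpenArmL n N ∩ (zdSepDualArmT n N ∩ zdSepDualArmB n N) := rfl

/-! ### Monotonicity and locality -/

/-- The edge-disjoint right pair event is increasing. [folklore] -/
theorem isUpperSet_zdSepOpenPairRE (n N : ℕ) : IsUpperSet (zdSepOpenPairRE n N) := by
  rintro ω ω' hle ⟨A, B, hAB⟩
  exact ⟨A.mono hle, B.mono hle, by simpa using hAB⟩

/-- The open part of the event is increasing. [folklore] -/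
theorem isUpperSet_zdSepOpenPairRE_inter_zdSepOpenArmL (n N : ℕ) :
    IsUpperSet (zdSepOpenPairRE n N ∩ zdSepOpenArmL n N) :=
  (isUpperSet_zdSepOpenPairRE n N).inter (isUpperSet_zdSepOpenArmL n N)

/-- **The edge-disjoint right pair event is determined by the pairs of the right zone.** [folklore] -/
theorem determinedBy_zdSepOpenPairRE {n N : ℕ} {F : Set (Sym2 (Site 2))} (hF : (zdSepZoneR n N).sym2 ⊆ F) :
    DeterminedBy (zdSepOpenPairRE n N) F := by
  have hB : ∀ {ω : BondConfig (Site 2)} {lo hi lo' hi' : ℤ} (A : ZdSepOpenArmR ω n N lo hi lo' hi'),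
      |lo| ≤ ((n / 4 : ℕ) : ℤ) + (n / 64 : ℕ) → |hi| ≤ ((n / 4 : ℕ) : ℤ) + (n / 64 : ℕ) →
      |lo'| ≤ ((N / 4 : ℕ) : ℤ) + (N / 64 : ℕ) → |hi'| ≤ ((N / 4 : ℕ) : ℤ) + (N / 64 : ℕ) →
      A.carrier ⊆ zdSepZoneR n N := by
    intro ω lo hi lo' hi' A h1 h2 h3 h4 v hv
    rcases A.carrier_subset h1 h2 h3 h4 hv with h | h | h
    · exact Or.inl h
    · exact Or.inr (Or.inl ⟨h.1, h.2.1, by have := h.2.2; push_cast at this ⊢; omega⟩)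
    · exact Or.inr (Or.inr ⟨h.1, h.2.1, by have := h.2.2; push_cast at this ⊢; omega⟩)
  suffices key : ∀ ω ω' : BondConfig (Site 2), ω ∩ F = ω' ∩ F →
      ω ∈ zdSepOpenPairRE n N → ω' ∈ zdSepOpenPairRE n N by
    rw [determinedBy_iff]
    exact fun ω ω' h => ⟨key ω ω' h, key ω' ω h.symm⟩
  rintro ω ω' h ⟨A, B, hAB⟩
  have hA := hB A (abs_le.2 ⟨by omega, by omega⟩) (abs_le.2 ⟨by omega, by omega⟩)
    (abs_le.2 ⟨by omega, by omega⟩) (abs_le.2 ⟨by omega, by omega⟩)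
  have hB' := hB B (abs_le.2 ⟨by omega, by omega⟩) (abs_le.2 ⟨by omega, by omega⟩)
    (abs_le.2 ⟨by omega, by omega⟩) (abs_le.2 ⟨by omega, by omega⟩)
  refine ⟨A.transport fun e he heω => mem_of_inter_eq h (hF (mem_sym2_of_forall fun x hx => hA (he x hx))) heω,
    B.transport fun e he heω => mem_of_inter_eq h (hF (mem_sym2_of_forall fun x hx => hB' (he x hx))) heω,
    ?_⟩
  simpa using hAB

/-- The zone form used downstream: the open part of `zdFiveArmSepE` is determined by any pair set
containing the pairs of the right and left zones. [folklore] -/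
theorem determinedBy_zdSepOpenPairRE_inter_zdSepOpenArmL {n N : ℕ} {F : Set (Sym2 (Site 2))}
    (hR : (zdSepZoneR n N).sym2 ⊆ F) (hL : (zdSepZoneL n N).sym2 ⊆ F) :
    DeterminedBy (zdSepOpenPairRE n N ∩ zdSepOpenArmL n N) F :=
  (determinedBy_zdSepOpenPairRE hR).inter (determinedBy_zdSepOpenArmL hL)

/-- **The event is a five-arm-type event**: it is contained in the one-arm (crossing) event of the
annulus, for `1 ≤ n ≤ N`. [folklore] -/
theorem zdFiveArmSepE_subset_sqAnnulusOpenCrossing {n N : ℕ} (hn : 1 ≤ n) (hnN : n ≤ N) :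
    zdFiveArmSepE n N ⊆ sqAnnulusOpenCrossing n N := by
  rintro ω ⟨⟨⟨A, -, -⟩, -⟩, -⟩
  refine A.mem_sqAnnulusOpenCrossing hn hnN ?_ ?_ ?_ ?_ <;> push_cast <;> omega

/-! ### Gluing lemmas for the right arm with edge bookkeeping -/

section GlueOpenE

variable {ω : BondConfig (Site 2)} {n N : ℕ} {lo hi lo' hi' B₀ : ℤ} {s y : Site 2}

/-- **Outer gluing, right arm, with edges** (`ZdSepOpenArmR.exists_walk_of_outerCorridor` with the
bookkeeping that the glued walk uses edges of the edge carrier only): a crossing `T` of the corridor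
attached to the outer fence box meets the fence crossing, whence an open walk from the inner endpoint
of the arm to a vertex of `T` along the body, the attaching walk and the fence crossing.
[cite: Nolin2008, §4.3, proof of Prop. 12 (arXiv 0711.4948: Prop. 11)] -/
theorem ZdSepOpenArmR.exists_walk_of_outerCorridorE (A : ZdSepOpenArmR ω n N lo hi B₀ (B₀ + (N / 64 : ℕ)))
    (hE : 1 ≤ N / 8) (T : (zdGraph 2).Walk s y) (hs : s 0 = N + 1) (hy : (N : ℤ) + (N / 8 : ℕ) ≤ y 0)
    (hT : ∀ z ∈ T.support, (N : ℤ) + 1 ≤ z 0 ∧ (z 0 ≤ N + (N / 8 : ℕ) → B₀ ≤ z 1 ∧ z 1 ≤ B₀ + (N / 64 : ℕ))) :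
    ∃ m ∈ T.support, ∃ U : (zdGraph 2).Walk A.x m,
      (∀ z ∈ U.support, z ∈ A.carrier) ∧ (∀ e ∈ U.edges, e ∈ A.edgeCarrier) ∧ ∀ e ∈ U.edges, e ∈ ω := by
  obtain ⟨q, T₁, hq, hT₁s, -⟩ := exists_prefix_reach_ge 0 T ((N : ℤ) + (N / 8 : ℕ)) (by rw [hs]; omega) hy
  have hbox : ∀ z ∈ T₁.support, (N : ℤ) + 1 ≤ z 0 ∧ z 0 ≤ N + (N / 8 : ℕ) ∧ B₀ ≤ z 1 ∧ z 1 ≤ B₀ + (N / 64 : ℕ) := by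
    intro z hz
    obtain ⟨h1, h2⟩ := hT₁s z hz
    obtain ⟨h3, h4⟩ := hT z h2
    exact ⟨h3, h1, h4 h1⟩
  have hz := A.hz
  obtain ⟨m, hmT, hmV⟩ := exists_mem_support_of_vFence (L := (N : ℤ) + 1) (R := (N : ℤ) + (N / 8 : ℕ))
    (B₀ := B₀) (B₁ := B₀ + (N / 64 : ℕ)) A.V (fun z hz => ⟨(A.hV z hz).1, (A.hV z hz).2.1⟩)
    (by rw [A.hab.1]; omega) (by rw [A.hab.2]; omega) (by omega) T₁ hs hq hbox
  obtain ⟨Uv, hUvs, hUve⟩ := exists_walk_within_support A.V A.hu hmV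
  refine ⟨m, (hT₁s m hmT).2, A.W.append (A.P.append Uv), fun z hz => ?_, fun e he => ?_, fun e he => ?_⟩
  · rw [Walk.mem_support_append_iff, Walk.mem_support_append_iff] at hz
    rcases hz with hz | hz | hz
    · exact Or.inl hz
    · exact Or.inr (Or.inr (Or.inl hz))
    · exact Or.inr (Or.inl (hUvs z hz))
  · rw [Walk.edges_append, List.mem_append, Walk.edges_append, List.mem_append] at he
    rcases he with he | he | he
    · exact Or.inl he
    · exact Or.inr (Or.inr (Or.inl he))
    · exact Or.inr (Or.inl (hUve e he))
  · rw [Walk.edges_append, List.mem_append, Walk.edges_append, List.mem_append] at he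
    rcases he with he | he | he
    · exact A.hWo e he
    · exact A.hPo e he
    · exact A.hVo e (hUve e he)

/-- **Inner gluing, right arm, with edges** (`ZdSepOpenArmR.exists_walk_of_innerCorridor` with edge
bookkeeping: inner attaching walk and inner fence crossing). [cite: Nolin2008, §4.3, proof of Prop. 12 (arXiv 0711.4948: Prop. 11)] -/
theorem ZdSepOpenArmR.exists_walk_of_innerCorridorE (A : ZdSepOpenArmR ω n N B₀ (B₀ + (n / 64 : ℕ)) lo' hi')
    (he : 1 ≤ n / 8) (T : (zdGraph 2).Walk s y) (hy : y 0 + 1 = n) (hs : s 0 ≤ (n : ℤ) - (n / 8 : ℕ))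
    (hT : ∀ z ∈ T.support, z 0 + 1 ≤ n ∧ ((n : ℤ) - (n / 8 : ℕ) ≤ z 0 → B₀ ≤ z 1 ∧ z 1 ≤ B₀ + (n / 64 : ℕ))) :
    ∃ m ∈ T.support, ∃ U : (zdGraph 2).Walk A.x m,
      (∀ z ∈ U.support, z ∈ A.carrier) ∧ (∀ e ∈ U.edges, e ∈ A.edgeCarrier) ∧ ∀ e ∈ U.edges, e ∈ ω := by
  obtain ⟨q, T₁, hq, hT₁s, -⟩ :=
    exists_prefix_reach_le 0 T.reverse ((n : ℤ) - (n / 8 : ℕ)) (by omega) hs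
  have hbox : ∀ z ∈ T₁.reverse.support, (n : ℤ) - (n / 8 : ℕ) ≤ z 0 ∧ z 0 ≤ (n : ℤ) - 1 ∧
      B₀ ≤ z 1 ∧ z 1 ≤ B₀ + (n / 64 : ℕ) := by
    intro z hz
    rw [Walk.support_reverse, List.mem_reverse] at hz
    obtain ⟨h1, h2⟩ := hT₁s z hz
    rw [Walk.support_reverse, List.mem_reverse] at h2
    obtain ⟨h3, h4⟩ := hT z h2
    exact ⟨h1, by omega, h4 h1⟩
  have hx := A.hx
  obtain ⟨m, hmT, hmV⟩ := exists_mem_support_of_vFence (L := (n : ℤ) - (n / 8 : ℕ)) (R := (n : ℤ) - 1)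
    (B₀ := B₀) (B₁ := B₀ + (n / 64 : ℕ)) A.V' (fun z hz => ⟨(A.hV' z hz).1, by have := (A.hV' z hz).2.1; omega⟩)
    (by rw [A.hab'.1]; omega) (by rw [A.hab'.2]; omega) (by omega) T₁.reverse hq (by omega) hbox
  obtain ⟨Uv, hUvs, hUve⟩ := exists_walk_within_support A.V' A.hu' hmV
  have hmT' : m ∈ T.support := by
    rw [Walk.support_reverse, List.mem_reverse] at hmT
    have := (hT₁s m hmT).2
    rwa [Walk.support_reverse, List.mem_reverse] at this
  refine ⟨m, hmT', A.P'.append Uv, fun z hz => ?_, fun e he => ?_, fun e he => ?_⟩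
  · rw [Walk.mem_support_append_iff] at hz
    rcases hz with hz | hz
    · exact Or.inr (Or.inr (Or.inr (Or.inr hz)))
    · exact Or.inr (Or.inr (Or.inr (Or.inl (hUvs z hz))))
  · rw [Walk.edges_append, List.mem_append] at he
    rcases he with he | he
    · exact Or.inr (Or.inr (Or.inr (Or.inr he)))
    · exact Or.inr (Or.inr (Or.inr (Or.inl (hUve e he))))
  · rw [Walk.edges_append, List.mem_append] at he
    rcases he with he | he
    · exact A.hP'o e he
    · exact A.hV'o e (hUve e he)

end GlueOpenE

end Literature.Probability.Percolation

end
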